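import Literature.NumberTheory.Sieve.MoebiusShiftedPrimesArcsProofs
import Literature.NumberTheory.Sieve.MoebiusShiftedPrimesMajorArcsProofs
import Literature.NumberTheory.Sieve.MoebiusShiftedPrimesMajorArcsVinogradov
import Literature.NumberTheory.Sieve.MoebiusShiftedPrimesArcsWith
import Literature.NumberTheory.LFunctions.VinogradovZetaSumEstimate
import HarnessLib

/-!
# Möbius on shifted primes — the remaining named facts of Lichtman 2020, discharged

Topic `Literature/NumberTheory/Sieve`; leaf companion of the `MoebiusShiftedPrimes*.lean` cluster vendoring
J. D. Lichtman, *Averages of the Möbius function on shifted primes*, Q. J. Math. 73 (2022) 729–757,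
doi:10.1093/qmath/haab054 = arXiv:2009.08969v2 [Lichtman2020] (held copy `paper:arxiv-2009.08969`; page numbers
below are PDF pages).  Everything in this file is PROVED; it introduces no definition and no named fact.

The one printed input of the paper that is not elementary — the Vinogradov–Korobov zero-free region for
Dirichlet `L`-functions behind Lemma 4.5 (p. 12; Khale's (1.4) = Montgomery, *Ten lectures*, p. 176) — is a
theorem of the tree: `VKZeta.exists_hasVKZeroFreeRegion : ∃ c > 0, HasVKZeroFreeRegion c 21`
(`Literature/NumberTheory/LFunctions/VinogradovZetaSumEstimate.lean`: Vinogradov's mean value theorem, Ivić's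
Lemmas 6.1–6.3 ⟹ Ivić's Theorem 6.2 for the shifted zeta sums ⟹ `VinogradovRangeBound` ⟹ `ExpSumBound` ⟹
Richert-type bounds for `ζ` and `L(s, χ)` ⟹ the region).  Every named fact of the cluster had already been reduced
in the tree to such a region with an arbitrary constant (`…_of_vk` theorems); this file composes the two, so that
the following named facts now hold unconditionally (Theorem 2.2 itself, `Lichtman2020_keyFourierEstimate_holds`,
is `MoebiusShiftedPrimesKeyFourierHolds.lean`; Proposition 2.3 as printed,
`Lichtman2020_keyFourierEstimateLiouville_holds`, is `MoebiusShiftedPrimesLiouville33.lean`):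

* `Lichtman2020_primeCharacterSum_holds` — **Lemma 4.5** (p. 12), via
  `Lichtman2020.PrimeCharSum.Lichtman2020_primeCharacterSum_of_vk`;
* `Lichtman2020_liouvilleMeanSquare_holds` — **Proposition 3.4** (p. 10), and
  `Lichtman2020_majorArcEstimate_holds` — **Proposition 3.2** (p. 9), via `MoebiusShiftedPrimesMajorArcsVinogradov.lean`;
* `Lichtman2020_keyFourierEstimateLiouville'_holds` — **Proposition 2.3** in the regime form of
  `MoebiusShiftedPrimesArcs.lean` (p. 8), via `Lichtman2020_keyFourierEstimateLiouville'_of_vk`;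
* along the corrected typical sets `S_c`, `c ≥ 100` (`MoebiusShiftedPrimesTypical.lean`, `…ArcsWith.lean`):
  `Lichtman2020_dirichletMeanValueWith_holds` (**Proposition 5.1**, p. 14), `Lichtman2020_liouvilleMeanSquareWith_holds`
  (Proposition 3.4), `Lichtman2020_majorArcEstimateWith_holds` (Proposition 3.2),
  `Lichtman2020_keyFourierEstimateLiouvilleWith'_holds` (Proposition 2.3), `Lichtman2020_keyFourierEstimateWith_holds`
  (Theorem 2.2), via `MoebiusShiftedPrimesMajorArcsProofs.lean` and `Lichtman2020_keyFourierEstimateLiouvilleWith'_of_arcs`;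
* `lichtman2020_moebius_shifted_primes_avg_power_holds` and `lichtman2020_moebius_shifted_primes_avg_holds` —
  **Theorem 1.1** (p. 3: "If `log H/log₂ X → ∞` then `∑_{h ≤ H} |∑_{p ≤ X} μ(p + h)| = o(Hπ(X))`; further if
  `H = X^θ`, `θ ∈ (0,1)`, then `≪_δ Hπ(X)/(log X)^{1/3−δ}`"), via
  `lichtman2020_moebius_shifted_primes_avg(_power)_of_vk` (Lemma 4.8 `Lichtman2020_liouvilleCharacterSifted_holds` and
  Siegel–Walfisz for `μ`, `SiegelWalfiszMoebius_holds`, being theorems of the tree).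

## References

* J. D. Lichtman, *Averages of the Möbius function on shifted primes*, Q. J. Math. 73 (2022), 729–757,
  doi:10.1093/qmath/haab054, arXiv:2009.08969: Theorem 1.1 (p. 3), Theorem 2.2 and Proposition 2.3 (pp. 7–8),
  Propositions 3.2, 3.4 (pp. 9–10), Lemma 4.5 (p. 12), Proposition 5.1 (p. 14). [cite: Lichtman2020, Theorem 1.1]
* A. Ivić, *The Riemann Zeta-Function*, John Wiley & Sons 1985 (Dover 2003), Ch. 6, Theorems 6.1–6.2, Lemma 6.3.
  [cite: Ivic1985, Theorem 6.1]
-/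

noncomputable section

namespace Literature.NumberTheory.Sieve

open Literature.NumberTheory.LFunctions

/-! ### Lemma 4.5 and the major arcs as printed -/

/-- **Lichtman 2020, Lemma 4.5 — DISCHARGED** (the prime character sum bound from the Vinogradov–Korobov
region: `Lichtman2020_primeCharacterSum_of_vk` fed with `VKZeta.exists_hasVKZeroFreeRegion`).
[cite: Lichtman2020, Lemma 4.5] [cite: Ivic1985, Theorem 6.1] -/
theorem Lichtman2020_primeCharacterSum_holds : Lichtman2020_primeCharacterSum := by
  obtain ⟨c, hc, hVK⟩ := VKZeta.exists_hasVKZeroFreeRegion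
  exact Lichtman2020.PrimeCharSum.Lichtman2020_primeCharacterSum_of_vk hc hVK

/-- **Lichtman 2020, Proposition 3.4 AS PRINTED — DISCHARGED** (`Lichtman2020_liouvilleMeanSquare_of_vk`).
[cite: Lichtman2020, Proposition 3.4] -/
theorem Lichtman2020_liouvilleMeanSquare_holds : Lichtman2020_liouvilleMeanSquare := by
  obtain ⟨c, hc, hVK⟩ := VKZeta.exists_hasVKZeroFreeRegion
  exact Lichtman2020_liouvilleMeanSquare_of_vk hc hVK

/-- **Lichtman 2020, Proposition 3.2 AS PRINTED — DISCHARGED** (`Lichtman2020_majorArcEstimate_of_vk`).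
[cite: Lichtman2020, Proposition 3.2] -/
theorem Lichtman2020_majorArcEstimate_holds : Lichtman2020_majorArcEstimate := by
  obtain ⟨c, hc, hVK⟩ := VKZeta.exists_hasVKZeroFreeRegion
  exact Lichtman2020_majorArcEstimate_of_vk hc hVK

/-- **Lichtman 2020, Proposition 2.3 (regime form `Lichtman2020_keyFourierEstimateLiouville'`) — DISCHARGED**
(`Lichtman2020_keyFourierEstimateLiouville'_of_vk`). [cite: Lichtman2020, Proposition 2.3] -/
theorem Lichtman2020_keyFourierEstimateLiouville'_holds : Lichtman2020_keyFourierEstimateLiouville' := by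
  obtain ⟨c, hc, hVK⟩ := VKZeta.exists_hasVKZeroFreeRegion
  exact Lichtman2020_keyFourierEstimateLiouville'_of_vk hc hVK

/-! ### Along the corrected typical sets `S_c` (`c ≥ 100`) -/

/-- **Lichtman 2020, Proposition 5.1 along `S_c` — DISCHARGED** (`Lichtman2020_dirichletMeanValueWith_of_vk`).
[cite: Lichtman2020, Proposition 5.1] -/
theorem Lichtman2020_dirichletMeanValueWith_holds : Lichtman2020_dirichletMeanValueWith := by
  obtain ⟨c, hc, hVK⟩ := VKZeta.exists_hasVKZeroFreeRegion
  exact Lichtman2020_dirichletMeanValueWith_of_vk hc hVK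

/-- **Lichtman 2020, Proposition 3.4 along `S_c` — DISCHARGED** (`Lichtman2020_liouvilleMeanSquareWith_of_vk`).
[cite: Lichtman2020, Proposition 3.4] -/
theorem Lichtman2020_liouvilleMeanSquareWith_holds : Lichtman2020_liouvilleMeanSquareWith := by
  obtain ⟨c, hc, hVK⟩ := VKZeta.exists_hasVKZeroFreeRegion
  exact Lichtman2020_liouvilleMeanSquareWith_of_vk hc hVK

/-- **Lichtman 2020, Proposition 3.2 along `S_c` — DISCHARGED** (`Lichtman2020_majorArcEstimateWith_of_vk`).
[cite: Lichtman2020, Proposition 3.2] -/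
theorem Lichtman2020_majorArcEstimateWith_holds : Lichtman2020_majorArcEstimateWith := by
  obtain ⟨c, hc, hVK⟩ := VKZeta.exists_hasVKZeroFreeRegion
  exact Lichtman2020_majorArcEstimateWith_of_vk hc hVK

/-- **Lichtman 2020, Proposition 2.3 along `S_c` — DISCHARGED** (minor arcs `Lichtman2020_minorArcEstimateWith_holds`,
major arcs `Lichtman2020_majorArcEstimateWith_holds`, combined by `Lichtman2020_keyFourierEstimateLiouvilleWith'_of_arcs`).
[cite: Lichtman2020, Proposition 2.3] -/
theorem Lichtman2020_keyFourierEstimateLiouvilleWith'_holds : Lichtman2020_keyFourierEstimateLiouvilleWith' :=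
  Lichtman2020_keyFourierEstimateLiouvilleWith'_of_arcs Lichtman2020_minorArcEstimateWith_holds
    Lichtman2020_majorArcEstimateWith_holds

/-- **Lichtman 2020, Theorem 2.2 along `S_c` — DISCHARGED** (`Lichtman2020_keyFourierEstimateWith_of_vk`).
[cite: Lichtman2020, Theorem 2.2] -/
theorem Lichtman2020_keyFourierEstimateWith_holds : Lichtman2020_keyFourierEstimateWith := by
  obtain ⟨c, hc, hVK⟩ := VKZeta.exists_hasVKZeroFreeRegion
  exact Lichtman2020_keyFourierEstimateWith_of_vk hc hVK

/-! ### Theorem 1.1 -/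

/-- **Lichtman 2020, Theorem 1.1, power range `H = X^θ` — DISCHARGED**: for `θ ∈ (0,1)` and `δ > 0`,
`∑_{h ≤ H} |∑_{p ≤ X} μ(p + h)| ≪ Hπ(X)/(log X)^{1/3−δ}` (`lichtman2020_moebius_shifted_primes_avg_power_of_vk`:
Lemma 4.5 from the region, Lemma 4.8 and Siegel–Walfisz for `μ` proved in the tree).
[cite: Lichtman2020, Theorem 1.1] [cite: Ivic1985, Theorem 6.1] -/
theorem lichtman2020_moebius_shifted_primes_avg_power_holds : lichtman2020_moebius_shifted_primes_avg_power := by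
  obtain ⟨c, hc, hVK⟩ := VKZeta.exists_hasVKZeroFreeRegion
  exact lichtman2020_moebius_shifted_primes_avg_power_of_vk hc hVK

/-- **Lichtman 2020, Theorem 1.1, qualitative part — DISCHARGED**: if `log H/log log X → ∞` (and `H ≤ X`),
`∑_{h ≤ H} |∑_{p ≤ X} μ(p + h)| = o(Hπ(X))` (`lichtman2020_moebius_shifted_primes_avg_of_vk`).
[cite: Lichtman2020, Theorem 1.1] [cite: Ivic1985, Theorem 6.1] -/
theorem lichtman2020_moebius_shifted_primes_avg_holds : lichtman2020_moebius_shifted_primes_avg := by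
  obtain ⟨c, hc, hVK⟩ := VKZeta.exists_hasVKZeroFreeRegion
  exact lichtman2020_moebius_shifted_primes_avg_of_vk hc hVK

end Literature.NumberTheory.Sieve
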